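import Summits.PneNP.PneNP.Theorems.PhaseTwinsMacroscopicTwinsAboveDefs

/-!
# Route PhaseTwins, crux `MacroscopicTwinsAbove` (stmt-PneNP-2720), line `literal-gadgets-cfi-apparatus`:
# configurations of the literal-gadget graphs (support for `stub_connector`, part 1)

Bookkeeping for Sly's Lemma 2.2 on the literal-gadget wiring `lgGraph E loc W b` / `lgBase nv m W`
(definitions file `PhaseTwinsMacroscopicTwinsAboveDefs`):

* `isIndepSet_fromRel_iff`, `isIndepSet_lgBase_iff`, `isIndepSet_lgGraph_iff` — independence of a configuration
  in the base graph (every copy fibre independent in the gadget) and in the wired graph (additionally: no pair edge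
  doubly occupied, every occupied end has its port vacant, no inner–end edge of a complex doubly occupied);
* `cfgEquiv` — a configuration of `LGVert nv m v K` is the same as (family of copy fibres, complex part), with its
  membership and cardinality lemmas and the reindexing of sums `sum_cfgEquiv`;
* `hardcoreZOn_lgBase_phase` — `Z_base(Y) = Π_g Z_G(Y_g) · (1+λ)^{10mK}`; `independencePolynomial_lgBase` —
  `Z(lgBase) = Z_G^{|copies|} · (1+λ)^{10mK}`; `phaseProbs_lgBase` — `(phaseProbs)` from `(GpropA)`:
  `n^{-2nv} Z(lgBase) ≤ Z_base(Y)`.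

All statements are elementary finite combinatorics (the pattern of the tree's `isIndepSet_gadgetSubst_iff`,
`hardcoreZOn_gadgetSubst_bot_phaseVec`, `phaseProbs_of_slyPropA` for Sly's `gadgetSubst`). [folklore]
-/

noncomputable section

open scoped Classical BigOperators

namespace Summit.PneNP.PneNP.Cruxes.MacroscopicTwinsAbove.LiteralGadgetsCfiApparatus

open Finset
open Literature.Computability.Complexity (hardcoreZOn hardcoreZOn_def slyPhase SlyPropA sum_hardcoreZOn_fiber)
open Literature.ModelTheory.FiniteModelTheory.CFIMatching (bit)
open Literature.Probability.LatticeModels (independencePolynomial independencePolynomial_pos)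

-- `Summit.PneNP.PneNP.…` (summit = sub-problem name) trips the duplicate-namespace linter on every declaration.
set_option linter.dupNamespace false

variable {nv m v P κ₁ D K : ℕ}

/-! ## Independence in the two graphs -/

/-- A finite vertex set is independent in `SimpleGraph.fromRel r` iff no two DISTINCT members are `r`-related. -/
theorem isIndepSet_fromRel_iff {α : Type*} (r : α → α → Prop) (I : Finset α) :
    (SimpleGraph.fromRel r).IsIndepSet (↑I : Set α) ↔ ∀ a ∈ I, ∀ c ∈ I, a ≠ c → ¬ r a c := by
  constructor
  · intro h a ha c hc hac hr
    exact h (Finset.mem_coe.2 ha) (Finset.mem_coe.2 hc) hac ((SimpleGraph.fromRel_adj r a c).2 ⟨hac, Or.inl hr⟩)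
  · intro h a ha c hc hac hadj
    rcases ((SimpleGraph.fromRel_adj r a c).1 hadj).2 with hr | hr
    · exact h a (Finset.mem_coe.1 ha) c (Finset.mem_coe.1 hc) hac hr
    · exact h c (Finset.mem_coe.1 hc) a (Finset.mem_coe.1 ha) (Ne.symm hac) hr

/-- Independence of a copy fibre, spelled out. -/
theorem isIndepSet_lgFib_iff (G : SimpleGraph (Fin v)) (I : Finset (LGVert nv m v K)) (g : Fin nv × ZMod 2) :
    G.IsIndepSet (↑(lgFib I g) : Set (Fin v)) ↔
      ∀ y y' : Fin v, (Sum.inl (g.1, g.2, y) : LGVert nv m v K) ∈ I →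
        (Sum.inl (g.1, g.2, y') : LGVert nv m v K) ∈ I → ¬ G.Adj y y' := by
  constructor
  · intro h y y' hy hy' hadj
    exact h (Finset.mem_coe.2 ((mem_lgFib I g y).2 hy)) (Finset.mem_coe.2 ((mem_lgFib I g y').2 hy'))
      (G.ne_of_adj hadj) hadj
  · intro h y hy y' hy' _ hadj
    exact h y y' ((mem_lgFib I g y).1 (Finset.mem_coe.1 hy)) ((mem_lgFib I g y').1 (Finset.mem_coe.1 hy')) hadj

/-- **Independent sets of the base graph**: a configuration is independent in `lgBase` iff every copy fibre is
independent in the gadget. -/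
theorem isIndepSet_lgBase_iff (W : LWiring v P κ₁ D K) (I : Finset (LGVert nv m v K)) :
    (lgBase nv m W).IsIndepSet (↑I : Set (LGVert nv m v K)) ↔
      ∀ g : Fin nv × ZMod 2, W.G.IsIndepSet (↑(lgFib I g) : Set (Fin v)) := by
  unfold lgBase
  rw [isIndepSet_fromRel_iff]
  constructor
  · intro h g
    rw [isIndepSet_lgFib_iff]
    intro y y' hy hy' hadj
    refine h _ hy _ hy' (fun heq => ?_) ?_
    · simp only [Sum.inl.injEq, Prod.mk.injEq, true_and] at heq
      exact W.G.ne_of_adj hadj heq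
    · exact ⟨rfl, rfl, hadj⟩
  · intro h a ha c hc _ hr
    rcases a with ⟨x, a, y⟩ | ⟨e, j, i, a⟩ | ⟨e, j, S'⟩ <;> rcases c with ⟨x', a', y'⟩ | ⟨e', j', i', a'⟩ | ⟨e', j', S''⟩ <;>
      simp only [lgBaseRel] at hr
    obtain ⟨rfl, rfl, hadj⟩ := hr
    exact (isIndepSet_lgFib_iff W.G I (x', a')).1 (h (x', a')) y y' ha hc hadj

/-- **Independent sets of the literal-gadget graph**: a configuration is independent in `lgGraph E loc W b` iff
(copies) every copy fibre is independent in the gadget, (pairs) no pair edge `V^±(slot j)` of `g_{x,0}`–`g_{x,1}` is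
doubly occupied, (ends) every occupied end `(e, j, i, a)` has its port in `g_{E e i, a}` vacant, and (complexes) no
inner–end edge `(e, j, S') — (e, j, i, bit (b e) S' i)` is doubly occupied. -/
theorem isIndepSet_lgGraph_iff (E : Fin m → Fin 3 → Fin nv) (loc : Fin m × Fin 3 → Fin D) (W : LWiring v P κ₁ D K)
    (b : Fin m → ZMod 2) (I : Finset (LGVert nv m v K)) :
    (lgGraph E loc W b).IsIndepSet (↑I : Set (LGVert nv m v K)) ↔
      (∀ g : Fin nv × ZMod 2, W.G.IsIndepSet (↑(lgFib I g) : Set (Fin v))) ∧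
      (∀ (x : Fin nv) (j : Fin κ₁),
          ¬ ((Sum.inl (x, 0, W.Vp (W.slot (Sum.inl j))) : LGVert nv m v K) ∈ I ∧
              (Sum.inl (x, 1, W.Vp (W.slot (Sum.inl j))) : LGVert nv m v K) ∈ I) ∧
          ¬ ((Sum.inl (x, 0, W.Vm (W.slot (Sum.inl j))) : LGVert nv m v K) ∈ I ∧
              (Sum.inl (x, 1, W.Vm (W.slot (Sum.inl j))) : LGVert nv m v K) ∈ I)) ∧
      (∀ (e : Fin m) (j : Fin K) (i : Fin 3) (a : ZMod 2),
          (Sum.inr (Sum.inl (e, j, i, a)) : LGVert nv m v K) ∈ I →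
            (Sum.inl (E e i, a, W.Vp (W.slot (Sum.inr (loc (e, i), j)))) : LGVert nv m v K) ∉ I) ∧
      (∀ (e : Fin m) (j : Fin K) (S' : Fin 2 → ZMod 2) (i : Fin 3),
          (Sum.inr (Sum.inr (e, j, S')) : LGVert nv m v K) ∈ I →
            (Sum.inr (Sum.inl (e, j, i, bit (b e) S' i)) : LGVert nv m v K) ∉ I) := by
  have h01 : ∀ a : ZMod 2, a = 0 ∨ a = 1 := by decide
  have h11 : (1 : ZMod 2) + 1 = 0 := by decide
  unfold lgGraph
  rw [isIndepSet_fromRel_iff]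
  constructor
  · intro h
    refine ⟨fun g => ?_, fun x j => ⟨?_, ?_⟩, fun e j i a he hp => ?_, fun e j S' i hS hE => ?_⟩
    · rw [isIndepSet_lgFib_iff]
      intro y y' hy hy' hadj
      refine h _ hy _ hy' (fun heq => ?_) (Or.inl ⟨rfl, rfl, hadj⟩)
      simp only [Sum.inl.injEq, Prod.mk.injEq, true_and] at heq
      exact W.G.ne_of_adj hadj heq
    · rintro ⟨h0, h1⟩
      exact h _ h0 _ h1 (by simp) (Or.inr ⟨rfl, by simp, j, Or.inl ⟨rfl, rfl⟩⟩)
    · rintro ⟨h0, h1⟩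
      exact h _ h0 _ h1 (by simp) (Or.inr ⟨rfl, by simp, j, Or.inr ⟨rfl, rfl⟩⟩)
    · exact h _ he _ hp (by simp) ⟨rfl, rfl, rfl⟩
    · exact h _ hS _ hE (by simp) ⟨rfl, rfl, rfl⟩
  · rintro ⟨hcopy, hpair, hend, hcx⟩ a ha c hc hac hr
    rcases a with ⟨x, a, y⟩ | ⟨e, j, i, a⟩ | ⟨e, j, S'⟩ <;> rcases c with ⟨x', a', y'⟩ | ⟨e', j', i', a'⟩ | ⟨e', j', S''⟩ <;>
      simp only [lgRel] at hr
    · rcases hr with ⟨rfl, rfl, hadj⟩ | ⟨rfl, rfl, j, hj⟩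
      · exact (isIndepSet_lgFib_iff W.G I (x', a')).1 (hcopy (x', a')) y y' ha hc hadj
      · rcases hj with ⟨rfl, rfl⟩ | ⟨rfl, rfl⟩
        · rcases h01 a with rfl | rfl
          · exact (hpair x' j).1 ⟨ha, by simpa using hc⟩
          · exact (hpair x' j).1 ⟨by simpa [h11] using hc, ha⟩
        · rcases h01 a with rfl | rfl
          · exact (hpair x' j).2 ⟨ha, by simpa using hc⟩
          · exact (hpair x' j).2 ⟨by simpa [h11] using hc, ha⟩
    · obtain ⟨rfl, rfl, rfl⟩ := hr
      exact hend e j i a' ha hc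
    · obtain ⟨rfl, rfl, rfl⟩ := hr
      exact hcx e' j' S' i' ha hc

/-! ## Configurations as (copy fibres, complex part) -/

/-- The complex part of the vertex type: ends and inner vertices. -/
abbrev CxPart (m K : ℕ) : Type := (Fin m × Fin K × Fin 3 × ZMod 2) ⊕ (Fin m × Fin K × (Fin 2 → ZMod 2))

/-- **Configurations of `LGVert nv m v K` as pairs (family of copy fibres, complex part).** -/
def cfgEquiv (nv m v K : ℕ) :
    Finset (LGVert nv m v K) ≃ ((Fin nv × ZMod 2 → Finset (Fin v)) × Finset (CxPart m K)) where
  toFun I := (fun g => lgFib I g, I.toRight)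
  invFun SJ := (univ.filter fun c : Fin nv × ZMod 2 × Fin v => c.2.2 ∈ SJ.1 (c.1, c.2.1)).disjSum SJ.2
  left_inv I := by
    apply Finset.ext
    intro c
    rcases c with ⟨x, a, y⟩ | z
    · simp [mem_lgFib]
    · simp
  right_inv SJ := by
    obtain ⟨S, J⟩ := SJ
    simp only [toRight_disjSum, Prod.mk.injEq, and_true]
    funext g
    apply Finset.ext
    intro y
    simp [mem_lgFib]

/-- Membership of a copy vertex in the configuration built from `(S, J)`. -/
theorem inl_mem_cfgEquiv_symm (S : Fin nv × ZMod 2 → Finset (Fin v)) (J : Finset (CxPart m K))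
    (x : Fin nv) (a : ZMod 2) (y : Fin v) :
    (Sum.inl (x, a, y) : LGVert nv m v K) ∈ (cfgEquiv nv m v K).symm (S, J) ↔ y ∈ S (x, a) := by
  simp [cfgEquiv]

/-- Membership of a complex vertex in the configuration built from `(S, J)`. -/
theorem inr_mem_cfgEquiv_symm (S : Fin nv × ZMod 2 → Finset (Fin v)) (J : Finset (CxPart m K))
    (z : CxPart m K) :
    (Sum.inr z : LGVert nv m v K) ∈ (cfgEquiv nv m v K).symm (S, J) ↔ z ∈ J := by
  simp [cfgEquiv]

/-- The copy fibres of the configuration built from `(S, J)` are `S`. -/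
theorem lgFib_cfgEquiv_symm (S : Fin nv × ZMod 2 → Finset (Fin v)) (J : Finset (CxPart m K))
    (g : Fin nv × ZMod 2) : lgFib ((cfgEquiv nv m v K).symm (S, J)) g = S g := by
  ext y
  rw [mem_lgFib]
  exact inl_mem_cfgEquiv_symm S J g.1 g.2 y

/-- The phase vector of the configuration built from `(S, J)` reads only `S`. -/
theorem lgPhase_cfgEquiv_symm (W : LWiring v P κ₁ D K) (S : Fin nv × ZMod 2 → Finset (Fin v))
    (J : Finset (CxPart m K)) :
    lgPhase W ((cfgEquiv nv m v K).symm (S, J)) = fun g => slyPhase W.Wp W.Wm (S g) := by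
  funext g
  show slyPhase W.Wp W.Wm (lgFib _ g) = _
  rw [lgFib_cfgEquiv_symm]

/-- The size of the configuration built from `(S, J)`: the fibre sizes plus the complex part. -/
theorem card_cfgEquiv_symm (S : Fin nv × ZMod 2 → Finset (Fin v)) (J : Finset (CxPart m K)) :
    ((cfgEquiv nv m v K).symm (S, J)).card = (∑ g, (S g).card) + J.card := by
  show ((univ.filter fun c : Fin nv × ZMod 2 × Fin v => c.2.2 ∈ S (c.1, c.2.1)).disjSum J).card = _
  rw [card_disjSum]
  congr 1
  rw [card_eq_sum_card_fiberwise (f := fun c : Fin nv × ZMod 2 × Fin v => (c.1, c.2.1)) (t := univ)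
    fun _ _ => mem_coe.2 (mem_univ _)]
  refine sum_congr rfl fun g _ => ?_
  let emb : Fin v ↪ Fin nv × ZMod 2 × Fin v := ⟨fun y => (g.1, g.2, y), fun y y' h => by simpa using h⟩
  rw [← Finset.card_map emb]
  congr 1
  apply Finset.ext
  rintro ⟨x, a, y⟩
  simp only [mem_filter, mem_univ, true_and, mem_map, emb, Function.Embedding.coeFn_mk]
  constructor
  · rintro ⟨hy, h⟩
    subst h
    exact ⟨y, hy, rfl⟩
  · rintro ⟨y', hy', h⟩
    simp only [Prod.mk.injEq] at h
    obtain ⟨rfl, rfl, rfl⟩ := h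
    exact ⟨hy', rfl⟩

/-- **Reindexing sums over configurations** by (copy fibres, complex part). -/
theorem sum_cfgEquiv {β : Type*} [AddCommMonoid β] (f : Finset (LGVert nv m v K) → β) :
    ∑ I, f I = ∑ S : Fin nv × ZMod 2 → Finset (Fin v), ∑ J : Finset (CxPart m K), f ((cfgEquiv nv m v K).symm (S, J)) := by
  rw [← Fintype.sum_prod_type']
  exact Fintype.sum_equiv (cfgEquiv nv m v K) _ _ fun I => by
    rw [← Prod.mk.eta (p := cfgEquiv nv m v K I), Equiv.symm_apply_apply]

/-- The number of complex vertices: `10·m·K`. -/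
theorem card_CxPart (m K : ℕ) : Fintype.card (CxPart m K) = 10 * m * K := by
  simp only [CxPart, Fintype.card_sum, Fintype.card_prod, Fintype.card_fin, ZMod.card, Fintype.card_fun]
  ring

/-! ## The base graph: product formula and `(phaseProbs)` -/

/-- **`Z_base(Y) = Π_g Z_G(Y_g) · (1+λ)^{10mK}`**: on the disjoint union of the literal gadgets the phase-restricted
partition function factorises over the copies, the isolated complex vertices contributing `(1+λ)` each. -/
theorem hardcoreZOn_lgBase_phase (W : LWiring v P κ₁ D K) (lam : ℝ) (Y : Fin nv × ZMod 2 → Bool) :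
    hardcoreZOn (lgBase nv m W) lam (fun I => lgPhase W I = Y) =
      (∏ g : Fin nv × ZMod 2, hardcoreZOn W.G lam (fun S => slyPhase W.Wp W.Wm S = Y g)) *
        (1 + lam) ^ (10 * m * K) := by
  rw [hardcoreZOn_def, sum_cfgEquiv]
  simp only [hardcoreZOn_def]
  rw [Fintype.prod_sum]
  have hX : (1 + lam) ^ (10 * m * K) = ∑ J : Finset (CxPart m K), lam ^ J.card := by
    have := Fintype.sum_pow_mul_eq_add_pow (CxPart m K) lam 1
    simp only [one_pow, mul_one] at this
    rw [this, card_CxPart, add_comm]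
  rw [hX, Finset.sum_mul_sum]
  refine Finset.sum_congr rfl fun S _ => Finset.sum_congr rfl fun J _ => ?_
  have hiff : (lgBase nv m W).IsIndepSet (↑((cfgEquiv nv m v K).symm (S, J)) : Set (LGVert nv m v K)) ∧
        lgPhase W ((cfgEquiv nv m v K).symm (S, J)) = Y ↔
      ∀ g, W.G.IsIndepSet (↑(S g) : Set (Fin v)) ∧ slyPhase W.Wp W.Wm (S g) = Y g := by
    rw [isIndepSet_lgBase_iff, lgPhase_cfgEquiv_symm, funext_iff, ← forall_and]
    simp only [lgFib_cfgEquiv_symm]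
  by_cases h : ∀ g, W.G.IsIndepSet (↑(S g) : Set (Fin v)) ∧ slyPhase W.Wp W.Wm (S g) = Y g
  · rw [if_pos (hiff.2 h), card_cfgEquiv_symm, pow_add, ← prod_pow_eq_pow_sum]
    congr 1
    exact Finset.prod_congr rfl fun g _ => (if_pos (h g)).symm
  · rw [if_neg (fun h' => h (hiff.1 h'))]
    obtain ⟨g, hg⟩ := not_forall.1 h
    symm
    apply mul_eq_zero_of_left
    exact Finset.prod_eq_zero (Finset.mem_univ g) (if_neg hg)

/-- **`Z(lgBase) = Z_G^{|copies|} · (1+λ)^{10mK}`.** -/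
theorem independencePolynomial_lgBase (W : LWiring v P κ₁ D K) (lam : ℝ) :
    independencePolynomial (lgBase nv m W) lam =
      independencePolynomial W.G lam ^ Fintype.card (Fin nv × ZMod 2) * (1 + lam) ^ (10 * m * K) := by
  rw [← sum_hardcoreZOn_fiber (lgBase nv m W) lam (lgPhase W)]
  simp_rw [hardcoreZOn_lgBase_phase]
  rw [← Finset.sum_mul]
  congr 1
  rw [← Fintype.prod_sum fun (g : Fin nv × ZMod 2) (s : Bool) => hardcoreZOn W.G lam fun S => slyPhase W.Wp W.Wm S = s]
  rw [← Finset.card_univ, ← prod_const]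
  refine prod_congr rfl fun g _ => ?_
  exact sum_hardcoreZOn_fiber W.G lam (slyPhase W.Wp W.Wm)

/-- **`(phaseProbs)` from `(GpropA)`**: `n^{-2nv} · Z(lgBase) ≤ Z_base(Y)` for every phase vector `Y`. -/
theorem phaseProbs_lgBase (W : LWiring v P κ₁ D K) {lam : ℝ} (hlam : 0 ≤ lam) {n : ℕ}
    (hA : SlyPropA W.G lam W.Wp W.Wm n) (Y : Fin nv × ZMod 2 → Bool) :
    ((n : ℝ) ^ (2 * nv))⁻¹ * independencePolynomial (lgBase nv m W) lam ≤
      hardcoreZOn (lgBase nv m W) lam (fun I => lgPhase W I = Y) := by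
  rw [hardcoreZOn_lgBase_phase, independencePolynomial_lgBase]
  have hcard : Fintype.card (Fin nv × ZMod 2) = 2 * nv := by
    simp only [Fintype.card_prod, Fintype.card_fin, ZMod.card]; ring
  rw [hcard, ← mul_assoc]
  refine mul_le_mul_of_nonneg_right ?_ (pow_nonneg (by linarith) _)
  have hc : ((n : ℝ) ^ (2 * nv))⁻¹ * independencePolynomial W.G lam ^ (2 * nv) =
      ∏ _g : Fin nv × ZMod 2, independencePolynomial W.G lam / n := by
    rw [prod_const, Finset.card_univ, hcard, div_eq_mul_inv, mul_pow, mul_comm, inv_pow]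
  rw [hc]
  refine prod_le_prod (fun g _ => div_nonneg (independencePolynomial_pos W.G hlam).le n.cast_nonneg) fun g _ => ?_
  cases Y g
  · exact hA.2
  · exact hA.1

end Summit.PneNP.PneNP.Cruxes.MacroscopicTwinsAbove.LiteralGadgetsCfiApparatus
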